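import Literature.NumberTheory.LFunctions.Zhang2022.RepairRplus
import Literature.NumberTheory.LFunctions.Zhang2022.KnifeEdgeSmoothClassFlat

/-!
# Zhang (2022) §18-margin repair rung — the BAND SLOT `E-004` (E*-bandwidth) as a displayed `Prop`, and the
# conditional flatness «from the wall»: discMean(any length ≥ P^{1+w}) vs discMean(P)

Trunk T-ANT (NumberTheory/LFunctions). Y. Zhang, *Discrete mean estimates and the Landau–Siegel
zero*, arXiv:2211.02515v1 (2022) [Zhang2022LandauSiegel] — **an unrefereed manuscript under
adjudication. WHAT THIS IS NOT: nothing here asserts or denies its Theorems 1–2 or any analytic lemma;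
no claim about Landau–Siegel zeros, about Parity, or about a repaired `Margin232` is made; and `DiscMeanBandWidth`
below is an E*-SLOT — a hypothesis SHAPE (a bare `Prop`, registry E-004), typed so that it can be priced and displayed
as a hypothesis; it is NOT asserted and NOT a cited result.** Cell `landau-siegel` (rung F-S3), sub-cell E, stub S-E-p2-2 of
`barrier/ASSIGNMENTS.md` v1.1.

The two currencies of `R⁺ \ R̄` in `RepairRplus.lean` (p455670) — the two-piece `X`-world (`KnifeEdge.InvisibleOverhang`)
and the discrete mean (`KnifeEdgeDiscMeanFlat.discMeanFlat`, p446527; all lengths: `KnifeEdgeSmoothClass.*`,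
p456650/p456962) — are separated by the BAND `z = log n/log P ∈ (1, 1+w]` just above the wall `n = P`: the
invisible-tail theorems decide everything beyond `P^{1+w}` for every FIXED `w > 0`, and say nothing about the band
(registry E-004 «E*-bandwidth»: the band piece of a smooth profile contributes `≤ C·width·(…)` to the discrete
mean — a `DiscMeanUpperWidth`-type bookkeeping statement, untyped so far, «unit systems to reconcile»).

* `DiscMeanBandWidth c′ w C` — THE SLOT, ONE normalisation (the planner's, ASSIGNMENTS S-E-p2-2): for all large `D`,
  every real primitive `χ (mod D)`, under the displayed (A)-hypothesis `Re ρ = ½` on the sampled zeros, for every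
  GLOBALLY 1-Lipschitz profile `g` with `‖g‖∞ ≤ 1` (the class text of OBJECTIVE §1.3 row `R⁺ \ R̄`), adding the band
  block `⌈P⌉ ≤ n < ⌈P^{1+w}⌉` changes the discrete mean by at most `C·w·(discMeanAbs(⌈P⌉) + discWeight)`:
  `|discMean(⌈P^{1+w}⌉) − discMean(⌈P⌉)| ≤ C·w·(discMeanAbs(⌈P⌉) + discWeight)`.
* `discMean_fromWall_of_bandWidth` — CONDITIONAL («closing past the wall needs ¬slot»-shape bookkeeping): the slot
  at `(w, C)` and `0 < w < δ` give, eventually and under the displayed (A)-hypothesis, for EVERY length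
  `⌈P^{1+w}⌉ ≤ N ≤ ⌈P^{1+δ}⌉`:
  `|discMean(N) − discMean(⌈P⌉)| ≤ C·w·(discMeanAbs(⌈P⌉) + discWeight) + P^{−w/8}·(discMeanAbs(⌈P^{1+w}⌉) + discWeight)`
  (slot + `KnifeEdgeSmoothClass.discMeanFlat_lengths`, triangle inequality);
* `discMean_fromWall_topVanishing_of_bandWidth` — the same for a profile vanishing on `[θ, ∞)`, `θ ≤ 1 + δ`, and
  EVERY `N ≥ ⌈P^{1+w}⌉` (the full polynomial of a smooth top-vanishing piece of any length vs its bulk below `P`).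

CURRENCY (REF-E C3(e)): discrete mean over the sampled zeros; hypotheses displayed: (b) `Re ρ = ½`, (c) the slot
`DiscMeanBandWidth c′ w C`. Nothing is claimed about the size of `C`, about `w = α̃ = log(Dt₀)/log P`
(`Skeleton.alphaTilde`, the manuscript's own band), or about the (A)-world main terms.

## References

* Y. Zhang, arXiv:2211.02515v1 (2022), §2 (2.14)–(2.20), (2.30), §7 (7.2) [p. 44], §8 Lemma 8.1.
  [cite: Zhang2022LandauSiegel, §§2, 7, 8]
-/

noncomputable section

open Real Complex
open scoped NNReal

namespace Literature.NumberTheory.LFunctions.Zhang2022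

namespace Repair

/-! ### The slot -/

/-- **E-004 / E*-bandwidth SLOT (hypothesis shape, displayed as a hypothesis where used; NOT asserted, not a cited result).**
`DiscMeanBandWidth c′ w C`: for all large `D` and every real primitive `χ (mod D)`, IF every sampled zero has
`Re ρ = ½`, then for every globally 1-Lipschitz profile `g` with `‖g‖∞ ≤ 1` the band block `⌈P⌉ ≤ n < ⌈P^{1+w}⌉`
changes the `Re 𝔠*·‖·‖²·Re ω`-weighted discrete mean of the profile polynomial by at most
`C·w·(discMeanAbs(⌈P⌉) + discWeight)`:
`|discMean c′ χ g ⌈P^{1+w}⌉ − discMean c′ χ g ⌈P⌉| ≤ C·w·(discMeanAbs c′ χ g ⌈P⌉ + discWeight c′ χ)`.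
(The registry's «band piece contributes ≤ C·width·discWeight», written with the bulk mean added so that one
normalisation serves profiles with `g(1) ≠ 0`; its negation is a band term of E*-strength.)
[cite: Zhang2022LandauSiegel, §2 (2.16)–(2.20), (2.30); §8 Lemma 8.1] -/
def DiscMeanBandWidth (c' w C : ℝ) : Prop :=
  Skeleton.ForAllLarge fun D _ χ =>
    (∀ i ∈ Skeleton.idx χ, (i.2).re = 1 / 2) →
      ∀ g : ℝ → ℂ, LipschitzWith 1 g → (∀ z, ‖g z‖ ≤ 1) →
        |discMean c' χ g ⌈Skeleton.bigP D ^ (1 + w)⌉₊ - discMean c' χ g ⌈Skeleton.bigP D⌉₊| ≤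
          C * w * (discMeanAbs c' χ g ⌈Skeleton.bigP D⌉₊ + discWeight c' χ)

/-- The slot is monotone in its constant: `C ≤ C′`, `0 ≤ w` give `DiscMeanBandWidth c′ w C → DiscMeanBandWidth c′ w C′`
(bookkeeping for pricing). [cite: Zhang2022LandauSiegel, §2 (2.16)–(2.20)] -/
theorem DiscMeanBandWidth.mono {c' w C C' : ℝ} (hw : 0 ≤ w) (hCC : C ≤ C') (h : DiscMeanBandWidth c' w C) :
    DiscMeanBandWidth c' w C' := by
  refine Skeleton.ForAllLarge.mono h ?_
  intro D _ χ _ _ hB hA g hg hg1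
  refine (hB hA g hg hg1).trans ?_
  have hS : 0 ≤ discMeanAbs c' χ g ⌈Skeleton.bigP D⌉₊ + discWeight c' χ :=
    add_nonneg (Finset.sum_nonneg fun _ _ => mul_nonneg (abs_nonneg _) (sq_nonneg _))
      (Finset.sum_nonneg fun _ _ => abs_nonneg _)
  exact mul_le_mul_of_nonneg_right (mul_le_mul_of_nonneg_right hCC hw) hS

/-! ### Conditional flatness from the wall -/

/-- **From the wall to any length, conditionally on the band slot.** If `DiscMeanBandWidth c′ w C` and
`0 < w < δ`, then for all large `D`, every real primitive `χ (mod D)`, under the displayed (A)-hypothesis, for every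
globally 1-Lipschitz `g` with `‖g‖∞ ≤ 1` and EVERY length `⌈P^{1+w}⌉ ≤ N ≤ ⌈P^{1+δ}⌉`:
`|discMean(N) − discMean(⌈P⌉)| ≤ C·w·(discMeanAbs(⌈P⌉) + discWeight) + P^{−w/8}·(discMeanAbs(⌈P^{1+w}⌉) + discWeight)`
(slot for the band + `KnifeEdgeSmoothClass.discMeanFlat_lengths` beyond it). Conditional: the slot is hypothesis
(c), never asserted. [cite: Zhang2022LandauSiegel, §2 (2.16)–(2.20); §8 Lemma 8.1] -/
theorem discMean_fromWall_of_bandWidth (c' : ℝ) {w δ C : ℝ} (hw : 0 < w) (hwδ : w < δ)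
    (hB : DiscMeanBandWidth c' w C) :
    Skeleton.ForAllLarge fun D _ χ =>
      (∀ i ∈ Skeleton.idx χ, (i.2).re = 1 / 2) →
        ∀ g : ℝ → ℂ, LipschitzWith 1 g → (∀ z, ‖g z‖ ≤ 1) →
          ∀ N : ℕ, ⌈Skeleton.bigP D ^ (1 + w)⌉₊ ≤ N → N ≤ ⌈Skeleton.bigP D ^ (1 + δ)⌉₊ →
            |discMean c' χ g N - discMean c' χ g ⌈Skeleton.bigP D⌉₊| ≤
              C * w * (discMeanAbs c' χ g ⌈Skeleton.bigP D⌉₊ + discWeight c' χ) +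
                Skeleton.bigP D ^ (-(w / 8)) *
                  (discMeanAbs c' χ g ⌈Skeleton.bigP D ^ (1 + w)⌉₊ + discWeight c' χ) := by
  have hT : Skeleton.ForAllLarge fun D _ χ =>
      (∀ i ∈ Skeleton.idx χ, (i.2).re = 1 / 2) →
        ∀ (g : ℝ → ℂ) (K : ℝ≥0) (M : ℝ), LipschitzOnWith K g (Set.Ici 1) →
          (∀ z : ℝ, 1 ≤ z → ‖g z‖ ≤ M) →
          ∀ N₁ N₂ : ℕ, ⌈Skeleton.bigP D ^ (1 + w)⌉₊ ≤ N₁ → N₁ ≤ N₂ → N₂ ≤ ⌈Skeleton.bigP D ^ (1 + δ)⌉₊ →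
            |discMean c' χ g N₂ - discMean c' χ g N₁| ≤
              Skeleton.bigP D ^ (-(w / 8)) * (discMeanAbs c' χ g N₁ + max (K : ℝ) M ^ 2 * discWeight c' χ) :=
    KnifeEdgeSmoothClass.discMeanFlat_lengths c' hw hwδ
  refine (Skeleton.ForAllLarge.and hB hT).mono ?_
  intro D _ χ _ _ h hA g hg hg1 N hN₁ hN₂
  have h1 := h.1 hA g hg hg1
  have h2 := h.2 hA g 1 1 hg.lipschitzOnWith (fun z _ => hg1 z) _ N le_rfl hN₁ hN₂
  have h2' : |discMean c' χ g N - discMean c' χ g ⌈Skeleton.bigP D ^ (1 + w)⌉₊| ≤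
      Skeleton.bigP D ^ (-(w / 8)) * (discMeanAbs c' χ g ⌈Skeleton.bigP D ^ (1 + w)⌉₊ + discWeight c' χ) := by
    simpa using h2
  calc |discMean c' χ g N - discMean c' χ g ⌈Skeleton.bigP D⌉₊|
      = |(discMean c' χ g ⌈Skeleton.bigP D ^ (1 + w)⌉₊ - discMean c' χ g ⌈Skeleton.bigP D⌉₊) +
          (discMean c' χ g N - discMean c' χ g ⌈Skeleton.bigP D ^ (1 + w)⌉₊)| := by ring_nf
    _ ≤ |discMean c' χ g ⌈Skeleton.bigP D ^ (1 + w)⌉₊ - discMean c' χ g ⌈Skeleton.bigP D⌉₊| +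
          |discMean c' χ g N - discMean c' χ g ⌈Skeleton.bigP D ^ (1 + w)⌉₊| := abs_add_le _ _
    _ ≤ _ := add_le_add h1 h2'

/-- **From the wall to the FULL polynomial of a top-vanishing piece, conditionally on the band slot.** If
`DiscMeanBandWidth c′ w C` and `0 < w < δ`, then eventually, under the displayed (A)-hypothesis, for every globally
1-Lipschitz `g` with `‖g‖∞ ≤ 1` vanishing on `[θ, ∞)` with `θ ≤ 1 + δ`, and EVERY `N ≥ ⌈P^{1+w}⌉` (no upper limit):
`|discMean(N) − discMean(⌈P⌉)| ≤ C·w·(discMeanAbs(⌈P⌉) + discWeight) + P^{−w/8}·(discMeanAbs(⌈P^{1+w}⌉) + discWeight)`.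
[cite: Zhang2022LandauSiegel, §2 (2.16)–(2.20); §8 Lemma 8.1] -/
theorem discMean_fromWall_topVanishing_of_bandWidth (c' : ℝ) {w δ C : ℝ} (hw : 0 < w) (hwδ : w < δ)
    (hB : DiscMeanBandWidth c' w C) :
    Skeleton.ForAllLarge fun D _ χ =>
      (∀ i ∈ Skeleton.idx χ, (i.2).re = 1 / 2) →
        ∀ g : ℝ → ℂ, LipschitzWith 1 g → (∀ z, ‖g z‖ ≤ 1) →
          ∀ θ : ℝ, θ ≤ 1 + δ → (∀ z, θ ≤ z → g z = 0) →
            ∀ N : ℕ, ⌈Skeleton.bigP D ^ (1 + w)⌉₊ ≤ N →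
              |discMean c' χ g N - discMean c' χ g ⌈Skeleton.bigP D⌉₊| ≤
                C * w * (discMeanAbs c' χ g ⌈Skeleton.bigP D⌉₊ + discWeight c' χ) +
                  Skeleton.bigP D ^ (-(w / 8)) *
                    (discMeanAbs c' χ g ⌈Skeleton.bigP D ^ (1 + w)⌉₊ + discWeight c' χ) := by
  have hT : Skeleton.ForAllLarge fun D _ χ =>
      (∀ i ∈ Skeleton.idx χ, (i.2).re = 1 / 2) →
        ∀ (g : ℝ → ℂ) (K : ℝ≥0) (M : ℝ), LipschitzOnWith K g (Set.Ici 1) →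
          (∀ z : ℝ, 1 ≤ z → ‖g z‖ ≤ M) →
          ∀ θ : ℝ, θ ≤ 1 + δ → (∀ z, θ ≤ z → g z = 0) →
            ∀ N : ℕ, ⌈Skeleton.bigP D ^ (1 + w)⌉₊ ≤ N →
              |discMean c' χ g N - discMean c' χ g ⌈Skeleton.bigP D ^ (1 + w)⌉₊| ≤
                Skeleton.bigP D ^ (-(w / 8)) *
                  (discMeanAbs c' χ g ⌈Skeleton.bigP D ^ (1 + w)⌉₊ + max (K : ℝ) M ^ 2 * discWeight c' χ) :=
    KnifeEdgeSmoothClass.discMeanFlat_topVanishing c' hw hwδ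
  refine (Skeleton.ForAllLarge.and hB hT).mono ?_
  intro D _ χ _ _ h hA g hg hg1 θ hθ hg0 N hN
  have h1 := h.1 hA g hg hg1
  have h2 := h.2 hA g 1 1 hg.lipschitzOnWith (fun z _ => hg1 z) θ hθ hg0 N hN
  have h2' : |discMean c' χ g N - discMean c' χ g ⌈Skeleton.bigP D ^ (1 + w)⌉₊| ≤
      Skeleton.bigP D ^ (-(w / 8)) * (discMeanAbs c' χ g ⌈Skeleton.bigP D ^ (1 + w)⌉₊ + discWeight c' χ) := by
    simpa using h2
  calc |discMean c' χ g N - discMean c' χ g ⌈Skeleton.bigP D⌉₊|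
      = |(discMean c' χ g ⌈Skeleton.bigP D ^ (1 + w)⌉₊ - discMean c' χ g ⌈Skeleton.bigP D⌉₊) +
          (discMean c' χ g N - discMean c' χ g ⌈Skeleton.bigP D ^ (1 + w)⌉₊)| := by ring_nf
    _ ≤ |discMean c' χ g ⌈Skeleton.bigP D ^ (1 + w)⌉₊ - discMean c' χ g ⌈Skeleton.bigP D⌉₊| +
          |discMean c' χ g N - discMean c' χ g ⌈Skeleton.bigP D ^ (1 + w)⌉₊| := abs_add_le _ _
    _ ≤ _ := add_le_add h1 h2'

end Repair

end Literature.NumberTheory.LFunctions.Zhang2022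

namespace Literature.NumberTheory.LFunctions.Zhang2022

namespace Repair

open scoped NNReal

/-! ### Appended: the slot over a profile class `V`, and the WALL-VALUE-ZERO slot of record for E-004

REF-B1 ruling (cell bus 2026-08-26T16:56:30Z, kernel locators `KnifeEdge.InClassPiece.vanish`,
`KnifeEdge.OverhangPiece.vanish`, p442741/p455670): the typed class `R⁺ \ R̄` has WALL VALUE ZERO, `g(1) = 0`. For a
profile with wall value `h = g(1) ≠ 0` the band block carries the band MAIN TERM of registry E-005 (`∝ |h|²`, sign `+`,
at the trivial scale) and the unrestricted slot `DiscMeanBandWidth` (all 1-Lipschitz `‖g‖ ≤ 1` profiles) is then an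
E-004 ∪ E-005 slot — its negation is expected to HOLD there, so the conditional theorems above are honest but idle on
such profiles. The E-004 slot OF RECORD is therefore the wall-value-zero one, `DiscMeanBandWidthWall0` below (same
normalisation, the extra binder `g 1 = 0` displayed); `DiscMeanBandWidth → DiscMeanBandWidthWall0`. Both are
hypothesis shapes, displayed where used, never asserted. -/

/-- **The band slot over a profile class `V`** (hypothesis shape; NOT asserted): for all large `D`, every real primitive
`χ (mod D)`, under the displayed (A)-hypothesis, for every profile `g` with `V g`, the band block `⌈P⌉ ≤ n < ⌈P^{1+w}⌉`
changes the discrete mean by at most `C·w·(discMeanAbs(⌈P⌉) + discWeight)`.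
[cite: Zhang2022LandauSiegel, §2 (2.16)–(2.20), (2.30); §8 Lemma 8.1] -/
def DiscMeanBandWidthOn (V : (ℝ → ℂ) → Prop) (c' w C : ℝ) : Prop :=
  Skeleton.ForAllLarge fun D _ χ =>
    (∀ i ∈ Skeleton.idx χ, (i.2).re = 1 / 2) →
      ∀ g : ℝ → ℂ, V g →
        |discMean c' χ g ⌈Skeleton.bigP D ^ (1 + w)⌉₊ - discMean c' χ g ⌈Skeleton.bigP D⌉₊| ≤
          C * w * (discMeanAbs c' χ g ⌈Skeleton.bigP D⌉₊ + discWeight c' χ)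

/-- The slot is antitone in the class: `V ⊆ V′` and the slot on `V′` give the slot on `V`.
[cite: Zhang2022LandauSiegel, §2 (2.16)–(2.20)] -/
theorem DiscMeanBandWidthOn.anti {V V' : (ℝ → ℂ) → Prop} {c' w C : ℝ} (hVV : ∀ g, V g → V' g)
    (h : DiscMeanBandWidthOn V' c' w C) : DiscMeanBandWidthOn V c' w C :=
  Skeleton.ForAllLarge.mono h fun _ _ _ _ _ hB hA g hg => hB hA g (hVV g hg)

/-- The unrestricted slot is the slot on the class «globally 1-Lipschitz, `‖g‖∞ ≤ 1`».
[cite: Zhang2022LandauSiegel, §2 (2.16)–(2.20)] -/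
theorem discMeanBandWidth_iff_on (c' w C : ℝ) :
    DiscMeanBandWidth c' w C ↔ DiscMeanBandWidthOn (fun g => LipschitzWith 1 g ∧ ∀ z, ‖g z‖ ≤ 1) c' w C := by
  constructor
  · intro h
    exact Skeleton.ForAllLarge.mono h fun _ _ _ _ _ hB hA g hg => hB hA g hg.1 hg.2
  · intro h
    exact Skeleton.ForAllLarge.mono h fun _ _ _ _ _ hB hA g hg hg1 => hB hA g ⟨hg, hg1⟩

/-- **E-004 SLOT OF RECORD (wall value zero; hypothesis shape, displayed where used; NOT asserted).**
`DiscMeanBandWidthWall0 c′ w C`: the band slot on the class «globally 1-Lipschitz, `‖g‖∞ ≤ 1`, `g(1) = 0`» — the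
profiles of `R⁺ \ R̄` as typed (wall value zero: `KnifeEdge.InClassPiece.vanish`, `KnifeEdge.OverhangPiece.vanish`):
eventually, under the displayed (A)-hypothesis,
`|discMean(⌈P^{1+w}⌉) − discMean(⌈P⌉)| ≤ C·w·(discMeanAbs(⌈P⌉) + discWeight)` for every such `g`.
Its negation = a band term of E*-strength for a profile VANISHING at the wall (registry E-004 proper, not E-005).
[cite: Zhang2022LandauSiegel, §2 (2.16)–(2.20), (2.30); §8 Lemma 8.1] -/
def DiscMeanBandWidthWall0 (c' w C : ℝ) : Prop :=
  DiscMeanBandWidthOn (fun g => LipschitzWith 1 g ∧ (∀ z, ‖g z‖ ≤ 1) ∧ g 1 = 0) c' w C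

/-- the unrestricted slot implies the wall-value-zero slot. [cite: Zhang2022LandauSiegel, §2 (2.16)–(2.20)] -/
theorem discMeanBandWidthWall0_of {c' w C : ℝ} (h : DiscMeanBandWidth c' w C) : DiscMeanBandWidthWall0 c' w C :=
  DiscMeanBandWidthOn.anti (fun _ hg => ⟨hg.1, hg.2.1⟩) ((discMeanBandWidth_iff_on c' w C).1 h)

/-- **From the wall to any length, conditionally on the band slot over a class `V` of profiles that are 1-Lipschitz and
bounded by `1` on `[1, ∞)`** (any behaviour below the wall allowed by `V`): slot on `V` and `0 < w < δ` give, eventually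
and under the displayed (A)-hypothesis, for every `g` with `V g` and every `⌈P^{1+w}⌉ ≤ N ≤ ⌈P^{1+δ}⌉`,
`|discMean(N) − discMean(⌈P⌉)| ≤ C·w·(discMeanAbs(⌈P⌉) + discWeight) + P^{−w/8}·(discMeanAbs(⌈P^{1+w}⌉) + discWeight)`.
[cite: Zhang2022LandauSiegel, §2 (2.16)–(2.20); §8 Lemma 8.1] -/
theorem discMean_fromWall_of_bandWidthOn {V : (ℝ → ℂ) → Prop} (c' : ℝ) {w δ C : ℝ} (hw : 0 < w) (hwδ : w < δ)
    (hV : ∀ g, V g → LipschitzOnWith 1 g (Set.Ici 1) ∧ ∀ z : ℝ, 1 ≤ z → ‖g z‖ ≤ 1)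
    (hB : DiscMeanBandWidthOn V c' w C) :
    Skeleton.ForAllLarge fun D _ χ =>
      (∀ i ∈ Skeleton.idx χ, (i.2).re = 1 / 2) →
        ∀ g : ℝ → ℂ, V g →
          ∀ N : ℕ, ⌈Skeleton.bigP D ^ (1 + w)⌉₊ ≤ N → N ≤ ⌈Skeleton.bigP D ^ (1 + δ)⌉₊ →
            |discMean c' χ g N - discMean c' χ g ⌈Skeleton.bigP D⌉₊| ≤
              C * w * (discMeanAbs c' χ g ⌈Skeleton.bigP D⌉₊ + discWeight c' χ) +
                Skeleton.bigP D ^ (-(w / 8)) *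
                  (discMeanAbs c' χ g ⌈Skeleton.bigP D ^ (1 + w)⌉₊ + discWeight c' χ) := by
  have hT : Skeleton.ForAllLarge fun D _ χ =>
      (∀ i ∈ Skeleton.idx χ, (i.2).re = 1 / 2) →
        ∀ (g : ℝ → ℂ) (K : ℝ≥0) (M : ℝ), LipschitzOnWith K g (Set.Ici 1) →
          (∀ z : ℝ, 1 ≤ z → ‖g z‖ ≤ M) →
          ∀ N₁ N₂ : ℕ, ⌈Skeleton.bigP D ^ (1 + w)⌉₊ ≤ N₁ → N₁ ≤ N₂ → N₂ ≤ ⌈Skeleton.bigP D ^ (1 + δ)⌉₊ →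
            |discMean c' χ g N₂ - discMean c' χ g N₁| ≤
              Skeleton.bigP D ^ (-(w / 8)) * (discMeanAbs c' χ g N₁ + max (K : ℝ) M ^ 2 * discWeight c' χ) :=
    KnifeEdgeSmoothClass.discMeanFlat_lengths c' hw hwδ
  refine (Skeleton.ForAllLarge.and hB hT).mono ?_
  intro D _ χ _ _ h hA g hg N hN₁ hN₂
  have h1 := h.1 hA g hg
  have h2 := h.2 hA g 1 1 (hV g hg).1 (hV g hg).2 _ N le_rfl hN₁ hN₂
  have h2' : |discMean c' χ g N - discMean c' χ g ⌈Skeleton.bigP D ^ (1 + w)⌉₊| ≤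
      Skeleton.bigP D ^ (-(w / 8)) * (discMeanAbs c' χ g ⌈Skeleton.bigP D ^ (1 + w)⌉₊ + discWeight c' χ) := by
    simpa using h2
  calc |discMean c' χ g N - discMean c' χ g ⌈Skeleton.bigP D⌉₊|
      = |(discMean c' χ g ⌈Skeleton.bigP D ^ (1 + w)⌉₊ - discMean c' χ g ⌈Skeleton.bigP D⌉₊) +
          (discMean c' χ g N - discMean c' χ g ⌈Skeleton.bigP D ^ (1 + w)⌉₊)| := by ring_nf
    _ ≤ |discMean c' χ g ⌈Skeleton.bigP D ^ (1 + w)⌉₊ - discMean c' χ g ⌈Skeleton.bigP D⌉₊| +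
          |discMean c' χ g N - discMean c' χ g ⌈Skeleton.bigP D ^ (1 + w)⌉₊| := abs_add_le _ _
    _ ≤ _ := add_le_add h1 h2'

/-- **From the wall to any length for the profiles of `R⁺ \ R̄` as typed (wall value zero), conditionally on the E-004
slot of record.** [cite: Zhang2022LandauSiegel, §2 (2.16)–(2.20); §8 Lemma 8.1] -/
theorem discMean_fromWall_of_bandWidthWall0 (c' : ℝ) {w δ C : ℝ} (hw : 0 < w) (hwδ : w < δ)
    (hB : DiscMeanBandWidthWall0 c' w C) :
    Skeleton.ForAllLarge fun D _ χ =>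
      (∀ i ∈ Skeleton.idx χ, (i.2).re = 1 / 2) →
        ∀ g : ℝ → ℂ, LipschitzWith 1 g → (∀ z, ‖g z‖ ≤ 1) → g 1 = 0 →
          ∀ N : ℕ, ⌈Skeleton.bigP D ^ (1 + w)⌉₊ ≤ N → N ≤ ⌈Skeleton.bigP D ^ (1 + δ)⌉₊ →
            |discMean c' χ g N - discMean c' χ g ⌈Skeleton.bigP D⌉₊| ≤
              C * w * (discMeanAbs c' χ g ⌈Skeleton.bigP D⌉₊ + discWeight c' χ) +
                Skeleton.bigP D ^ (-(w / 8)) *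
                  (discMeanAbs c' χ g ⌈Skeleton.bigP D ^ (1 + w)⌉₊ + discWeight c' χ) := by
  refine (discMean_fromWall_of_bandWidthOn c' hw hwδ ?_ hB).mono ?_
  · exact fun g hg => ⟨hg.1.lipschitzOnWith, fun z _ => hg.2.1 z⟩
  · intro D _ χ _ _ h hA g hg hg1 hg0
    exact h hA g ⟨hg, hg1, hg0⟩

end Repair

end Literature.NumberTheory.LFunctions.Zhang2022
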